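import Summits.HodgeConjecture.HodgeConjecture.Theorems.Ring2AbelianAllOneAnchorWeilCarrier
import Summits.HodgeConjecture.HodgeConjecture.Theorems.WeilTypeLadderLocalAnchor
import Summits.HodgeConjecture.HodgeConjecture.Theses.VHCAbelianSchemesRoad
import HarnessLib

/-!
# Ring 2 / AbelianAll (André column) × the Weil ladder — the ROWS of the one-anchor junction on the cell's named decls (leaf file)

research route, not a corollary; conditional on HC_CM plus one named minimal statement.

LEAF FILE (imports route files; nothing should import it). The junction `hasLocallyAlgebraicWeilAnchor_of_door_of_oneHyperbolicWeilCarrier` (PART AC-e,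
`Ring2AbelianAllOneAnchorWeilCarrier`, route-independent) composed with the Weil ladder's kernel theorems on hyperbolic members
(`WeilTypeLadder.weilClasses_algebraic_hyperbolic_of_localAnchor` and its named-rung corollaries; reach fact `weilFamilyReach_hyperbolic` — Deligne 1982 /
van Geemen / Landherr / Mumford–Fogarty–Kirwan / Milne, refereed inputs, by name):

* §1 **`weilClasses_algebraic_hyperbolic_of_reach_of_door_of_oneHyperbolicWeilCarrier`** — `n, d ≥ 1`: reach ∧ `LocalVariationalHodgeFor 𝒪` ∧
  `OneHyperbolicWeilCarrier 𝒪 n d` ⟹ the Weil plane of EVERY hyperbolic `(A, φ, h(e_A, a_A))` of dimension `2n`, `φ² = -d`, is algebraic.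
* §2 From the road's binders `ChernCharacterOnBetti`, `TwistedPerfectDoor` BY NAME: **`splitEightfolds_of_reach_of_twistedPerfectDoor_of_oneHyperbolicWeilTwistedCarrier`**
  (R2₈ `WeilTypeLadder.SplitEightfolds ⟸ K-C ∧ door ∧ reach ∧ (∀ d ≥ 1, OneHyperbolicWeilTwistedCarrier 4 d)` — ONE twisted carrier on ONE hyperbolic
  eightfold per `d`; Markman §1.2: nothing is known in dimension `≥ 8` for any `K`), `splitWeilAbelianVarieties_of_…` (R2, all `n ≥ 4`), and
  `markman2025_hyperbolicSixfold_of_reach_of_twistedPerfectDoor_of_oneHyperbolicWeilTwistedCarrier` (Markman's Thm. 1.5.1 STATEMENT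
  `Markman2025_weilClasses_algebraic_hyperbolicSixfold ⟸ K-C ∧ door ∧ reach ∧ (∀ d ≥ 1, OneHyperbolicWeilTwistedCarrier 3 d)` — the shape of his own
  proof, ONE semiregular twisted sheaf at ONE anchor per `d`, with anchor / object class / door as parameters).

HONEST: the carrier nodes are OPEN (`n ≥ 4`) / preprint-expected (`n = 3`, the secant anchor — the road's `SecantAnchorCarrier` files), not implied by
HC; the door is the road's binder (labels of the route file apply; `bfSingleAdmissible` disjunct: print supports `B₀ = 0` or initial-segment degree
sets — RING2-MAP §AbelianAll AA2.487). Nothing here says any carrier, door, rung, `HC_CM`, `HC_AV` or HC holds; `HC_CM` does not occur.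
References: [cite: Markman2025SecantWeil, Thm. 1.4.1, Thm. 1.5.1, §1.2 and §1.5] [cite: Deligne1982HodgeCycles, §4 proof of Thm. 4.8]
[cite: vanGeemen1994HodgeAV, proof of Thm. 6.12] [cite: BuchweitzFlenner2003, §5 Thm. 5.1] [cite: Bloch1972Semiregularity, Remark (7.5)]
[cite: Pridham2024Semiregularity, Cor. 2.25 and Rem. 2.26–2.27].
-/

noncomputable section

open CategoryTheory CategoryTheory.Limits AlgebraicGeometry Topology

namespace Summit.HodgeConjecture.HodgeConjecture.Ring2.AbelianAll

-- the cell's namespace repeats the summit name (`Summit.HodgeConjecture.HodgeConjecture…`), as in every `Ring2*` file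
set_option linter.dupNamespace false

open Literature.AlgebraicGeometry Literature.AlgebraicGeometry.Motives
open Literature.AlgebraicGeometry.HodgeTheory
open Literature.AlgebraicTopology.SingularHomology
open Summit.Ventures.HSemireg (ObjClass LocalVariationalHodgeFor)
open Summit.HodgeConjecture.HodgeConjecture.Theses
open Summit.HodgeConjecture.HodgeConjecture.WeilTypeLadder (SplitEightfolds SplitWeilAbelianVarieties
  weilClasses_algebraic_hyperbolic_of_localAnchor splitEightfolds_of_reach_of_localAnchor splitWeilAbelianVarieties_of_reach_of_localAnchor
  markman2025_hyperbolicSixfold_of_reach_of_localAnchor)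

variable {𝒪 : ObjClass} {n d : ℕ}

/-! ## §1 With Deligne's family with reach: every hyperbolic member -/

/-- **EVERY HYPERBOLIC WEIL-TYPE `2n`-FOLD FROM THE REACH FACT, THE DOOR AND ONE CARRIER** (`n, d ≥ 1`): the junction (`Ring2AbelianAllOneAnchorWeilCarrier` §1) composed with the
ladder's kernel theorem `WeilTypeLadder.weilClasses_algebraic_hyperbolic_of_localAnchor` (global class engine, rationality along the section,
local clause, Baire / countable union, one class suffices, isogeny transfer). [cite: Deligne1982HodgeCycles, §4 proof of Thm. 4.8]
[cite: Markman2025SecantWeil, proof of Thm. 1.5.1 (last paragraph)] [cite: vanGeemen1994HodgeAV, proof of Thm. 6.12] -/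
theorem weilClasses_algebraic_hyperbolic_of_reach_of_door_of_oneHyperbolicWeilCarrier (hn : 1 ≤ n) (hd : 1 ≤ d)
    (hF : weilFamilyReach_hyperbolic) (hT : LocalVariationalHodgeFor 𝒪) (hcar : OneHyperbolicWeilCarrier 𝒪 n d)
    (A : AbelianVariety ℂ) (φ : A ⟶ A) (hA : A.dim = 2 * n) (hφ : φ ≫ φ = -(d • 𝟙 A)) (eA : ProjectiveEmbedding A.X)
    (aA : complexBetti (projectiveSpace eA.n ℂ) 2) (haA : IsRationalClass aA) (haA0 : aA ≠ 0)
    (hhypA : IsHyperbolicWeilType A φ n ((d : ℂ) • complexBetti.map eA.ι 2 aA + complexBetti.map φ.hom.hom.hom 2 (complexBetti.map eA.ι 2 aA))) :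
    weilClassesOf A φ n d ≤ algebraicClasses A.X n :=
  weilClasses_algebraic_hyperbolic_of_localAnchor n d hn hd (hasLocallyAlgebraicWeilAnchor_of_door_of_oneHyperbolicWeilCarrier hT hcar) hF A φ
    hA hφ eA aA haA haA0 hhypA

/-! ## §2 On named decls: the split rungs and Markman's hyperbolic sixfolds from ONE carrier per `d` -/

/-- **R2₈ `SplitEightfolds ⟸ K-C ∧ TwistedPerfectDoor ∧ weilFamilyReach_hyperbolic ∧ (∀ d ≥ 1, OneHyperbolicWeilTwistedCarrier 4 d)`**: the Weil
classes of EVERY hyperbolic eightfold, every `d`, from ONE twisted carrier for ONE Weil class on ONE hyperbolic eightfold per `d` (Markman §1.2: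
«in dimension `≥ 8` nothing is known for any `K`» — this is the exact open content in carrier form). Road binders BY NAME.
[cite: Markman2025SecantWeil, §1.2] [cite: Deligne1982HodgeCycles, §4 proof of Thm. 4.8] [cite: Bloch1972Semiregularity, Remark (7.5)] -/
theorem splitEightfolds_of_reach_of_twistedPerfectDoor_of_oneHyperbolicWeilTwistedCarrier (hC : VHCAbelianSchemesRoad.ChernCharacterOnBetti)
    (hDoor : VHCAbelianSchemesRoad.TwistedPerfectDoor) (hF : weilFamilyReach_hyperbolic)
    (hcar : ∀ d : ℕ, 0 < d → OneHyperbolicWeilTwistedCarrier 4 d) : SplitEightfolds := by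
  obtain ⟨C⟩ := (hC : Nonempty ChernCharacterBetti)
  exact splitEightfolds_of_reach_of_localAnchor hF fun d hd ↦
    hasLocallyAlgebraicWeilAnchor_of_twistedPerfectDoorVHC_of_oneHyperbolicWeilCarrier (hDoor C) (hcar d hd C)

/-- **R2 `SplitWeilAbelianVarieties` (all `n ≥ 4`) ⟸ K-C ∧ TwistedPerfectDoor ∧ reach ∧ (∀ n ≥ 4, ∀ d ≥ 1, OneHyperbolicWeilTwistedCarrier n d)`.**
[cite: Markman2025SecantWeil, §1.2] [cite: Deligne1982HodgeCycles, §4 proof of Thm. 4.8] [cite: Bloch1972Semiregularity, Remark (7.5)] -/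
theorem splitWeilAbelianVarieties_of_reach_of_twistedPerfectDoor_of_oneHyperbolicWeilTwistedCarrier
    (hC : VHCAbelianSchemesRoad.ChernCharacterOnBetti) (hDoor : VHCAbelianSchemesRoad.TwistedPerfectDoor) (hF : weilFamilyReach_hyperbolic)
    (hcar : ∀ n : ℕ, 4 ≤ n → ∀ d : ℕ, 0 < d → OneHyperbolicWeilTwistedCarrier n d) : SplitWeilAbelianVarieties := by
  obtain ⟨C⟩ := (hC : Nonempty ChernCharacterBetti)
  exact splitWeilAbelianVarieties_of_reach_of_localAnchor hF fun n hn d hd ↦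
    hasLocallyAlgebraicWeilAnchor_of_twistedPerfectDoorVHC_of_oneHyperbolicWeilCarrier (hDoor C) (hcar n hn d hd C)

/-- **Markman's hyperbolic-sixfold STATEMENT (`Markman2025_weilClasses_algebraic_hyperbolicSixfold`, his Thm. 1.5.1) ⟸ K-C ∧ TwistedPerfectDoor ∧
reach ∧ (∀ d ≥ 1, OneHyperbolicWeilTwistedCarrier 3 d)** — the shape of his own proof (ONE semiregular twisted reflexive sheaf at ONE anchor per
`d`, §1.5 + Thm. 1.4.1), with the anchor, the object class and the door as parameters; the road's `SecantAnchorCarrier` files type his instance.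
[cite: Markman2025SecantWeil, Thm. 1.4.1, Thm. 1.5.1 and §1.5] [cite: Deligne1982HodgeCycles, §4 proof of Thm. 4.8] -/
theorem markman2025_hyperbolicSixfold_of_reach_of_twistedPerfectDoor_of_oneHyperbolicWeilTwistedCarrier
    (hC : VHCAbelianSchemesRoad.ChernCharacterOnBetti) (hDoor : VHCAbelianSchemesRoad.TwistedPerfectDoor) (hF : weilFamilyReach_hyperbolic)
    (hcar : ∀ d : ℕ, 0 < d → OneHyperbolicWeilTwistedCarrier 3 d) : Markman2025_weilClasses_algebraic_hyperbolicSixfold := by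
  obtain ⟨C⟩ := (hC : Nonempty ChernCharacterBetti)
  exact markman2025_hyperbolicSixfold_of_reach_of_localAnchor hF fun d hd ↦
    hasLocallyAlgebraicWeilAnchor_of_twistedPerfectDoorVHC_of_oneHyperbolicWeilCarrier (hDoor C) (hcar d hd C)

end Summit.HodgeConjecture.HodgeConjecture.Ring2.AbelianAll

end
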